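import Literature.AnabelianGeometry.EtaleTheta.Discharge.Sec2DoubleCoverProofs
import Literature.AnabelianGeometry.EtaleTheta.Discharge.Sec2InversionProofs
import Mathlib.Topology.Algebra.OpenSubgroup
import Mathlib.Topology.Algebra.Group.ClosedSubgroup
import HarnessLib

/-!
# [EtTh] Definition 2.3 over the interface: a `Π_C̲̲` of type `(1, l-torsΘ)±` from a `Π_C̲`, an inversion
# and a splitting — and its OPENNESS (proof-only; W3-L2-02, the `PiCuu` fields of `TemperedCoverData`)

Mochizuki, *The étale theta function and its Frobenioid-theoretic manifestations*, Publ. RIMS **45**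
(2009), §2, Def. 2.3 p. 38 (printed 264): "we shall write `C̲̲^log` for the orbicurve [of type
`(1, l-torsΘ)±`] … determined by `X̲̲^log`, `ι̲`", built from Prop. 2.2 (i)–(iii) pp. 36–38: the
`(−1)`-eigenspace `Im(s_ι)`, "a splitting of `D_x ↠ G_K`", and "a unique coset … such that `ι̲` has order
`2`" [cite: MochizukiEtTh2009, Def 2.3 p.38].

Cell abc-iut, layer L2, W3-L2-02 (seat abc-iut-L2-d3), PROOF-ONLY (no `def`). abc-iut-L2-t2's record
`ThetaCovers.TemperedCoverData` asks for a subgroup `PiCuu = Π_C̲̲ ⊆ Π_C` with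
`CoverData.IsTypeLTorsThetaPm PiCuu` (`∃ H' E S ι`: `Π_C̲ = H'` of type `(1, l-tors)±`, inversion `ι` with
`ι² ∈ Ker`, `(−1)`-eigenspace `E`, splitting `S`, `Π_C̲̲ = S·E·⟨ι⟩`) and `isOpen_PiCuu'`. Over ANY
`X : CoverDataAx l` this file PROVES, from abc-iut-L2-t10's discharges of Prop. 2.2
(`prop22_i_holds`: the eigenspace exists uniquely; `exists_inversion_sq_mem_barKer`: an inversion of
order `2` in `Δ̄_C̲` exists):

* `exists_isTypeLTorsThetaPm` — given `Π_C̲ = H'` of type `(1, l-tors)±`, ANY inversion `ι ∈ H'` and ANY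
  splitting `S`, there are `E`, `ι₀` with `IsTypeLTorsThetaPm ((S ⊔ E) ⊔ ⟨ι₀⟩)`: the Def. 2.3 datum
  EXISTS as soon as `(H', ι, S)` do;
* `index_splitting_sup_eigen` — `[Π_C : S·E] = 2·l·l` (`= [Π_C : Π_X̲̲]`, Rmk. 2.3.1);
* `relIndex_barTheta_deltaX` / `relIndex_barKer_deltaX` — `[Δ_X : Δ̄_Θ-preimage] = l²`, `[Δ_X : Ker] = l³`;
* `Subgroup.isClosed_of_isClosed_le_of_relIndex_ne_zero` — a subgroup containing a CLOSED subgroup with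
  finite index is closed; hence `isClosed_eigen` — `E` is closed (`Ker` is closed: field `isClosed_barKer`,
  ThetaCovers v3);
* `isOpen_splitting_sup_eigen_sup_zpowers` — over a COMPACT `Π_C`, if the splitting `S` is CLOSED then
  `S·E·⟨ι₀⟩` is OPEN (closed · compact = closed, finite index ⇒ open): the field `isOpen_PiCuu'` reduces to
  the closedness of the chosen splitting (a continuous section of `D̄_x ↠ G_K`).

Nothing here asserts that a `CoverDataAx` with a splitting exists; no side is taken on [IUTchIII] Cor. 3.12;
typed ≠ proved.
-/

namespace Literature.AnabelianGeometry.EtaleTheta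

namespace ThetaCovers

open scoped Pointwise

/-- A subgroup `K` containing a CLOSED subgroup `C` of finite relative index is closed (it is the finite
union of the closed cosets `k·C`). (Topological-group bookkeeping for [EtTh] Def 2.3.)
[cite: MochizukiEtTh2009, Def 2.3 p.38] -/
theorem _root_.Subgroup.isClosed_of_isClosed_le_of_relIndex_ne_zero {G : Type*} [Group G]
    [TopologicalSpace G] [ContinuousMul G] {C K : Subgroup G} (hle : C ≤ K)
    (hC : IsClosed (C : Set G)) (hidx : C.relIndex K ≠ 0) : IsClosed (K : Set G) := by
  classical
  haveI : (C.subgroupOf K).FiniteIndex := ⟨hidx⟩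
  haveI : Finite (K ⧸ C.subgroupOf K) := Subgroup.finite_quotient_of_finiteIndex
  have hcov : (K : Set G) =
      ⋃ q : K ⧸ C.subgroupOf K, (Homeomorph.mulLeft ((q.out : K) : G)) '' (C : Set G) := by
    ext k
    constructor
    · intro hk
      refine Set.mem_iUnion.2 ⟨QuotientGroup.mk (⟨k, hk⟩ : K), ?_⟩
      have h : (QuotientGroup.mk (⟨k, hk⟩ : K) : K ⧸ C.subgroupOf K).out⁻¹ * ⟨k, hk⟩ ∈
          C.subgroupOf K := by
        rw [← QuotientGroup.eq, QuotientGroup.out_eq']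
      rw [Subgroup.mem_subgroupOf] at h
      refine ⟨_, h, ?_⟩
      change ((QuotientGroup.mk (⟨k, hk⟩ : K) : K ⧸ C.subgroupOf K).out : G) *
        (((QuotientGroup.mk (⟨k, hk⟩ : K) : K ⧸ C.subgroupOf K).out : G)⁻¹ * k) = k
      rw [mul_inv_cancel_left]
    · intro hk
      obtain ⟨q, hq⟩ := Set.mem_iUnion.1 hk
      obtain ⟨c, hc, rfl⟩ := hq
      exact K.mul_mem (q.out).2 (hle hc)
  rw [hcov]
  exact isClosed_iUnion_of_finite fun q => (Homeomorph.mulLeft _).isClosed_image.2 hC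

namespace CoverDataAx

universe u

variable {l : ℕ} (X : CoverDataAx.{u} l)

/-! ### Existence of the Def 2.3 datum from `(H', ι, S)` -/

/-- **Def. 2.3 data exist from a `Π_C̲`, an inversion and a splitting**: for `H'` of type `(1, l-tors)±`,
an inversion `ι ∈ H'` and a splitting `S` of `D̄_x ↠ G_K`, there are an inversion `ι₀` with `ι₀² ∈ Ker`
(Prop. 2.2 (iii), `exists_inversion_sq_mem_barKer`) and its `(−1)`-eigenspace `E` (Prop. 2.2 (i),
`prop22_i_holds`) such that `Π_C̲̲ := S·E·⟨ι₀⟩` is of type `(1, l-torsΘ)±`.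
[cite: MochizukiEtTh2009, Def 2.3 p.38] -/
theorem exists_isTypeLTorsThetaPm {H' S : Subgroup X.PiC} {ι : X.PiC}
    (hH' : X.toCoverData.IsTypeLTorsPm H') (hι : X.toCoverData.IsInversion H' ι)
    (hS : X.toCoverData.IsSplitting S) :
    ∃ (E : Subgroup X.PiC) (ι₀ : X.PiC), X.toCoverData.IsInversion H' ι₀ ∧ ι₀ * ι₀ ∈ X.barKer ∧
      X.toCoverData.IsMinusEigen (H' ⊓ X.PiX) H' ι₀ E ∧
      X.toCoverData.IsTypeLTorsThetaPm ((S ⊔ E) ⊔ Subgroup.zpowers ι₀) := by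
  obtain ⟨E, hE, -⟩ := X.prop22_i_holds (H' ⊓ X.PiX) H' ι hH' rfl hι
  obtain ⟨ι₀, hι₀, hsq, -⟩ := X.exists_inversion_sq_mem_barKer hH' rfl hι hE
  obtain ⟨E₀, hE₀, -⟩ := X.prop22_i_holds (H' ⊓ X.PiX) H' ι₀ hH' rfl hι₀
  exact ⟨E₀, ι₀, hι₀, hsq, hE₀, ⟨⟨H', E₀, S, ι₀, hH', hι₀, hsq, hE₀, hS, rfl⟩⟩⟩

/-! ### Indices -/

/-- `S·E ≤ Π_X̲ = Π_C̲ ∩ Π_X` (`S ≤ D_x·Ker ≤ Π_X̲`, `E ≤ Δ_X̲`). [cite: MochizukiEtTh2009, Def 2.3 p.38] -/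
theorem splitting_sup_eigen_le {H' E S : Subgroup X.PiC} {ι : X.PiC}
    (hH' : X.toCoverData.IsTypeLTorsPm H') (hE : X.toCoverData.IsMinusEigen (H' ⊓ X.PiX) H' ι E)
    (hS : X.toCoverData.IsSplitting S) : S ⊔ E ≤ H' ⊓ X.PiX := by
  have hT := hH'.inf_isTypeLTors
  exact sup_le (hS.le.trans (sup_le hT.Dx_le (X.barKer_le_barTheta.trans hT.barTheta_le)))
    (hE.le.trans inf_le_left)

/-- **`[Π_C : S·E] = l·l·2`** (`[Π_X̲ : S·E] = l`, Rmk. 2.3.1 `index_typeLTorsTheta`; `[Π_X : Π_X̲] = l`,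
`index_typeLTors`; `[Π_C : Π_X] = 2`). [cite: MochizukiEtTh2009, Rmk 2.3.1 p.38] -/
theorem index_splitting_sup_eigen {H' E S : Subgroup X.PiC} {ι : X.PiC}
    (hH' : X.toCoverData.IsTypeLTorsPm H') (hE : X.toCoverData.IsMinusEigen (H' ⊓ X.PiX) H' ι E)
    (hS : X.toCoverData.IsSplitting S) : (S ⊔ E).index = l * l * 2 := by
  have h1 := X.index_typeLTorsTheta H' E S ι hH' hE hS
  have h2 := X.index_typeLTors _ hH'.inf_isTypeLTors
  rw [← Subgroup.relIndex_mul_index (X.splitting_sup_eigen_le hH' hE hS), h1,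
    ← Subgroup.relIndex_mul_index (inf_le_right : H' ⊓ X.PiX ≤ X.PiX), h2, X.index_PiX, mul_assoc]

/-- **`[Δ_X : Δ̄_Θ-preimage] = l·l`** (`Δ_X/barTheta ≅ (ℤ/l)²`, field `ell_rank_two`).
[cite: MochizukiEtTh2009, Def 2.1 p.35] -/
theorem relIndex_barTheta_deltaX : X.barTheta.relIndex X.DeltaX = l * l := by
  haveI := X.barTheta_normal
  obtain ⟨e⟩ := X.ell_rank_two
  rw [Subgroup.relIndex, Subgroup.index]
  change Nat.card (↥(X.PiX ⊓ X.aug.ker) ⧸ X.barTheta.subgroupOf (X.PiX ⊓ X.aug.ker)) = l * l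
  rw [Nat.card_congr e.toEquiv, Nat.card_congr Multiplicative.toAdd, Nat.card_prod, Nat.card_zmod]

/-- **`[Δ_X : Ker(Δ_X ↠ Δ̄_X)] = l·(l·l)`** (`#Δ̄_X = l³`). [cite: MochizukiEtTh2009, Def 2.1 p.35] -/
theorem relIndex_barKer_deltaX : X.barKer.relIndex X.DeltaX = l * (l * l) := by
  rw [← Subgroup.relIndex_mul_relIndex X.barKer X.barTheta X.DeltaX X.barKer_le_barTheta X.barTheta_le,
    X.relIndex_barKer, X.relIndex_barTheta_deltaX]

/-! ### Closedness of the eigenspace, openness of `Π_C̲̲` -/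

/-- **The `(−1)`-eigenspace `E` is closed in `Π_C`**: `Ker ≤ E ≤ Δ_X` with `Ker` closed (field
`isClosed_barKer`) and `[E : Ker] ∣ [Δ_X : Ker] = l³` finite. [cite: MochizukiEtTh2009, Prop 2.2(i) p.37] -/
theorem isClosed_eigen {H' E : Subgroup X.PiC} {ι : X.PiC}
    (hE : X.toCoverData.IsMinusEigen (H' ⊓ X.PiX) H' ι E) : IsClosed (E : Set X.PiC) := by
  have hEΔ : E ≤ X.DeltaX :=
    fun e he => ⟨(inf_le_right : H' ⊓ X.PiX ≤ X.PiX) (hE.le he).1, (hE.le he).2⟩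
  have hl : l ≠ 0 := by obtain ⟨k, hk⟩ := X.l_odd; omega
  refine Subgroup.isClosed_of_isClosed_le_of_relIndex_ne_zero hE.barKer_le X.isClosed_barKer ?_
  have h := Subgroup.relIndex_mul_relIndex X.barKer E X.DeltaX hE.barKer_le hEΔ
  rw [X.relIndex_barKer_deltaX] at h
  intro h0
  rw [h0, zero_mul] at h
  exact mul_ne_zero hl (mul_ne_zero hl hl) h.symm

/-- `S·E` as a set: `↑(S ⊔ E) = S * E` (`S ≤ Π_X̲` normalises `E`, field `IsMinusEigen.conj_mem`).
[cite: MochizukiEtTh2009, Prop 2.2(ii) p.37] -/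
theorem coe_splitting_sup_eigen {H' E S : Subgroup X.PiC} {ι : X.PiC}
    (hH' : X.toCoverData.IsTypeLTorsPm H') (hE : X.toCoverData.IsMinusEigen (H' ⊓ X.PiX) H' ι E)
    (hS : X.toCoverData.IsSplitting S) :
    ((S ⊔ E : Subgroup X.PiC) : Set X.PiC) = (S : Set X.PiC) * (E : Set X.PiC) := by
  refine Subgroup.coe_mul_of_left_le_normalizer_right S E fun s hs => ?_
  have hsH : s ∈ H' ⊓ X.PiX := X.splitting_sup_eigen_le hH' hE hS (Subgroup.mem_sup_left hs)
  rw [Subgroup.mem_normalizer_iff]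
  intro e
  constructor
  · exact fun he => hE.conj_mem s hsH e he
  · intro he
    have := hE.conj_mem s⁻¹ (Subgroup.inv_mem _ hsH) _ he
    simpa [mul_assoc] using this

/-- **`Π_C̲̲ = S·E·⟨ι₀⟩` is OPEN in a compact `Π_C` when the splitting `S` is CLOSED**: `S·E` is closed
(closed · compact) of finite index `2l²`, hence open, and `Π_C̲̲ ⊇ S·E`. This is the field
`TemperedCoverData.isOpen_PiCuu'` reduced to the closedness of the chosen splitting of `D̄_x ↠ G_K`.
[cite: MochizukiEtTh2009, Def 2.3 p.38] -/
theorem isOpen_splitting_sup_eigen_sup_zpowers [CompactSpace X.PiC] {H' E S : Subgroup X.PiC}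
    {ι : X.PiC} (hH' : X.toCoverData.IsTypeLTorsPm H')
    (hE : X.toCoverData.IsMinusEigen (H' ⊓ X.PiX) H' ι E) (hS : X.toCoverData.IsSplitting S)
    (hSc : IsClosed (S : Set X.PiC)) (ι₀ : X.PiC) :
    IsOpen (((S ⊔ E) ⊔ Subgroup.zpowers ι₀ : Subgroup X.PiC) : Set X.PiC) := by
  have hSE : IsClosed ((S ⊔ E : Subgroup X.PiC) : Set X.PiC) := by
    rw [X.coe_splitting_sup_eigen hH' hE hS]
    exact hSc.mul_right_of_isCompact (X.isClosed_eigen hE).isCompact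
  have hl : l ≠ 0 := by obtain ⟨k, hk⟩ := X.l_odd; omega
  haveI : (S ⊔ E).FiniteIndex :=
    ⟨by rw [X.index_splitting_sup_eigen hH' hE hS]; exact mul_ne_zero (mul_ne_zero hl hl) two_ne_zero⟩
  exact Subgroup.isOpen_mono le_sup_left (Subgroup.isOpen_of_isClosed_of_finiteIndex _ hSE)

/-- **Openness of `Π_C̲̲` packaged with existence**: over a compact `Π_C`, from `(H', ι, S)` with `S` closed
there are `E, ι₀` with `IsTypeLTorsThetaPm (S·E·⟨ι₀⟩)` AND `S·E·⟨ι₀⟩` open — both `PiCuu`-fields of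
`TemperedCoverData` at once. [cite: MochizukiEtTh2009, Def 2.3 p.38] -/
theorem exists_isTypeLTorsThetaPm_isOpen [CompactSpace X.PiC] {H' S : Subgroup X.PiC} {ι : X.PiC}
    (hH' : X.toCoverData.IsTypeLTorsPm H') (hι : X.toCoverData.IsInversion H' ι)
    (hS : X.toCoverData.IsSplitting S) (hSc : IsClosed (S : Set X.PiC)) :
    ∃ P : Subgroup X.PiC, X.toCoverData.IsTypeLTorsThetaPm P ∧ IsOpen (P : Set X.PiC) ∧ S ≤ P ∧
      P ⊓ X.PiX ≤ H' := by
  obtain ⟨E, ι₀, hι₀, -, hE, hP⟩ := X.exists_isTypeLTorsThetaPm hH' hι hS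
  refine ⟨(S ⊔ E) ⊔ Subgroup.zpowers ι₀, hP, X.isOpen_splitting_sup_eigen_sup_zpowers hH' hE hS hSc ι₀,
    le_sup_left.trans le_sup_left, ?_⟩
  have hle : (S ⊔ E) ⊔ Subgroup.zpowers ι₀ ≤ H' :=
    sup_le ((X.splitting_sup_eigen_le hH' hE hS).trans inf_le_left)
      ((Subgroup.zpowers_le (G := X.PiC)).2 hι₀.mem)
  exact (inf_le_inf_right _ hle).trans inf_le_left

end CoverDataAx

end ThetaCovers

end Literature.AnabelianGeometry.EtaleTheta
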